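import Summits.QuantumAdvantage.QuantumAdvantage.Theorems.HintDialClosure
import Summits.QuantumAdvantage.QuantumAdvantage.Theses.AnfPresentation

/-!
# GapDial (1/4) — the promise-gap dial of the signed cubic Forrelation problem in ANF presentation; THE ONE EQUIV

`GapSlice δ` is the promise problem «given a pair of cubic forms `(f, g)` on `n` variables in full ANF (`CubicANFPair.encode`), `n` even,
decide `Φ(f,g) ≥ δ(n)` (YES) versus `Φ(f,g) ≤ -δ(n)` (NO)».  LAWS: the slices shrink as `δ` grows (`gapSlice_yes_mono`, `gapSlice_no_mono`),
so hardness `GapSlice δ ∉ promiseLift C` is ANTITONE in `δ` (`gapSlice_not_mem_anti`) and antitone in the class (`gapSlice_not_mem_mono_class`);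
`gapSlice_disjoint`.  THE ONE EQUIV: since `|Φ| ≤ 1`, at `δ ≡ 1` the gap slice IS the exact slice —
`gapSlice_one_eq : GapSlice (fun _ ↦ 1) = SignedExactCubicSliceANF` (an equality of `PromiseProblem`s) — whence the junctions with the
TREE items by name: `anfPresentation_rungANonuniform_iff : AnfPresentation.RungANonuniform ↔ GapSlice 1 ∉ promiseLift (AC0Mod 2)` (27991),
`anfPresentation_rungA_iff` (27983), and the support-free necessity of every rung `δ ≤ 1`, in particular of the constant gap `3/5` of the
route's target `SignedCubicForrelationNotPrBPP` (`gapSlice_threeFifths_not_mem_of_rungANonuniform`).  No item is proved or refuted here.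

Package: four modules `GapDialSlice → GapDialFeedback → GapDialDilution → GapDialHalfLaw` (each imports its predecessor), to be landed AFTER the lens-3 g6
module `Theorems.HintDialClosure` (whose `IsLit/IsProj` projection calculus, code-length lemmas `lenB/uPoly/length_encode_pair_le`
(`Theorems.HintDialPlanting`, landed) and closure tool `not_promiseLift_AC0Mod_of_proj`, `dM/mv_dM` (`Theorems.HintDialClosure`) are used BY NAME).
Mathematical record: HOME/decomp-qadv-lens-3/g9/NODE-g9.md; node file (Theses-style, with the route pieces): HOME/decomp-qadv-lens-3/g9/GapDial.lean.
-/

set_option linter.dupNamespace false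

noncomputable section


namespace Summit.QuantumAdvantage.QuantumAdvantage.Theorems.GapDial

open Finset
open Literature.Computability.Complexity
open Literature.Computability.QuantumComplexity
open Literature.Computability.MetaComplexity
open _root_.Computability (encodeNat)
open Summit.QuantumAdvantage.QuantumAdvantage.Theorems.HintDial


/-! ## §3 ★ THE GAP DIAL — promise gap `δ(n)` instead of exactness; its laws; THE ONE EQUIV (`δ ≡ 1`) -/

section Dial

/-- YES instances at gap `δ`: even arity, `Φ ≥ δ(n)`. -/
def gapYes (δ : ℕ → ℝ) : Set CubicANFPair := {I | Even I.n ∧ δ I.n ≤ I.value}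

/-- NO instances at gap `δ`: even arity, `Φ ≤ -δ(n)`. -/
def gapNo (δ : ℕ → ℝ) : Set CubicANFPair := {I | Even I.n ∧ I.value ≤ -δ I.n}

/-- ★ THE GAP DIAL: the signed cubic Forrelation promise problem in ANF presentation with promise gap `δ`. -/
def GapSlice (δ : ℕ → ℝ) : PromiseProblem := ⟨CubicANFPair.encode '' gapYes δ, CubicANFPair.encode '' gapNo δ⟩

/-- DIAL LAW 1 (promise monotonicity): a smaller gap is a LARGER promise problem. -/
theorem gapSlice_yes_mono {δ δ' : ℕ → ℝ} (h : ∀ n, δ n ≤ δ' n) : (GapSlice δ').yes ≤ (GapSlice δ).yes :=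
  Set.image_mono fun _ hI => ⟨hI.1, (h _).trans hI.2⟩

/-- GapDial helper `gapSlice_no_mono` (lens-3 g9 GapDial THEOREMS package; see the enclosing section docstring). -/
theorem gapSlice_no_mono {δ δ' : ℕ → ℝ} (h : ∀ n, δ n ≤ δ' n) : (GapSlice δ').no ≤ (GapSlice δ).no :=
  Set.image_mono fun _ hI => ⟨hI.1, hI.2.trans (neg_le_neg (h _))⟩

/-- ★ DIAL LAW 2: hardness of the gap slice is ANTITONE in the gap — hardness at gap `δ'` gives hardness at every gap `δ ≤ δ'`
(a separator for the bigger promise problem separates the smaller one). -/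
theorem gapSlice_not_mem_anti {C : Set (Language Bool)} {δ δ' : ℕ → ℝ} (h : ∀ n, δ n ≤ δ' n) :
    GapSlice δ' ∉ promiseLift C → GapSlice δ ∉ promiseLift C :=
  fun hne hmem => hne (promiseLift_anti (gapSlice_yes_mono h) (gapSlice_no_mono h) hmem)

/-- DIAL LAW 3: hardness is antitone in the class. -/
theorem gapSlice_not_mem_mono_class {C C' : Set (Language Bool)} (hC : C' ⊆ C) (δ : ℕ → ℝ) :
    GapSlice δ ∉ promiseLift C → GapSlice δ ∉ promiseLift C' :=
  fun h hmem => h (promiseLift_mono hC hmem)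

/-- in particular from non-uniform `AC⁰[⊕]` to `AC⁰[⊕] ∩ P` (the class of the crux `RungA`). -/
theorem gapSlice_not_mem_inter_P (δ : ℕ → ℝ) :
    GapSlice δ ∉ promiseLift (AC0Mod 2) → GapSlice δ ∉ promiseLift (AC0Mod 2 ∩ Classes.P) :=
  gapSlice_not_mem_mono_class Set.inter_subset_left δ

/-! ### THE ONE EQUIV: at `δ ≡ 1` the gap slice IS the exact slice (`|Φ| ≤ 1`) -/

/-- GapDial helper `abs_value_le_one` (lens-3 g9 GapDial THEOREMS package; see the enclosing section docstring). -/
theorem abs_value_le_one (I : CubicANFPair) : |I.value| ≤ 1 := SgnForrMem.abs_forrelation_le_one _ _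

/-- GapDial helper `gapYes_one` (lens-3 g9 GapDial THEOREMS package; see the enclosing section docstring). -/
theorem gapYes_one : gapYes (fun _ => (1 : ℝ)) = {I | Even I.n ∧ I.value = 1} := by
  ext I
  have h := (abs_le.1 (abs_value_le_one I)).2
  simp only [gapYes, Set.mem_setOf_eq]
  constructor
  · rintro ⟨he, h1⟩; exact ⟨he, le_antisymm h h1⟩
  · rintro ⟨he, h1⟩; exact ⟨he, le_of_eq h1.symm⟩

/-- GapDial helper `gapNo_one` (lens-3 g9 GapDial THEOREMS package; see the enclosing section docstring). -/
theorem gapNo_one : gapNo (fun _ => (1 : ℝ)) = {I | Even I.n ∧ I.value = -1} := by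
  ext I
  have h := (abs_le.1 (abs_value_le_one I)).1
  simp only [gapNo, Set.mem_setOf_eq]
  constructor
  · rintro ⟨he, h1⟩; exact ⟨he, le_antisymm h1 h⟩
  · rintro ⟨he, h1⟩; exact ⟨he, le_of_eq h1⟩

/-- ★ THE TRANSLATION (set identity): `GapSlice 1 = SignedExactCubicSliceANF`. -/
theorem gapSlice_one_eq : GapSlice (fun _ => (1 : ℝ)) = SignedExactCubicSliceANF := by
  rw [GapSlice, gapYes_one, gapNo_one]; rfl

/-- ★★ THE ONE EQUIV of generation 9, as a junction with the TREE item 27991: route `AnfPresentation`'s `RungANonuniform` IS the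
top of the gap dial. -/
theorem anfPresentation_rungANonuniform_iff :
    Summit.QuantumAdvantage.QuantumAdvantage.Theses.AnfPresentation.RungANonuniform ↔
      GapSlice (fun _ => (1 : ℝ)) ∉ promiseLift (AC0Mod 2) := by
  rw [gapSlice_one_eq]; rfl

/-- (and the crux 27983 `AnfPresentation.RungA` is the top of the `AC⁰[⊕] ∩ P` dial). -/
theorem anfPresentation_rungA_iff :
    Summit.QuantumAdvantage.QuantumAdvantage.Theses.AnfPresentation.RungA ↔
      GapSlice (fun _ => (1 : ℝ)) ∉ promiseLift (AC0Mod 2 ∩ Classes.P) := by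
  rw [gapSlice_one_eq]; rfl

/-- ★ EVERY rung at gap `δ ≤ 1` is NECESSARY for item 27991 (EQUIV + dial law 2; support-free). -/
theorem gapSlice_not_mem_of_rungANonuniform {δ : ℕ → ℝ} (hδ : ∀ n, δ n ≤ 1) :
    Summit.QuantumAdvantage.QuantumAdvantage.Theses.AnfPresentation.RungANonuniform → GapSlice δ ∉ promiseLift (AC0Mod 2) :=
  fun h => gapSlice_not_mem_anti hδ (anfPresentation_rungANonuniform_iff.mp h)

/-- (and for the crux 27983 against `AC⁰[⊕] ∩ P`). -/
theorem gapSlice_not_mem_of_rungA {δ : ℕ → ℝ} (hδ : ∀ n, δ n ≤ 1) :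
    Summit.QuantumAdvantage.QuantumAdvantage.Theses.AnfPresentation.RungA → GapSlice δ ∉ promiseLift (AC0Mod 2 ∩ Classes.P) :=
  fun h => gapSlice_not_mem_anti hδ (anfPresentation_rungA_iff.mp h)

/-- In particular the node's piece `W` (gap `3/5`, the promise of the route's target `SignedCubicForrelationNotPrBPP`) is necessary
for item 27991, support-free. -/
theorem gapSlice_threeFifths_not_mem_of_rungANonuniform :
    Summit.QuantumAdvantage.QuantumAdvantage.Theses.AnfPresentation.RungANonuniform →
      GapSlice (fun _ => (3 / 5 : ℝ)) ∉ promiseLift (AC0Mod 2) :=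
  gapSlice_not_mem_of_rungANonuniform fun _ => by norm_num

/-- Honesty: every gap slice with `δ > 0` is a genuine (disjoint) promise problem. -/
theorem gapSlice_disjoint {δ : ℕ → ℝ} (hδ : ∀ n, 0 < δ n) : (GapSlice δ).Disjoint := by
  refine Set.disjoint_left.2 ?_
  rintro x ⟨I, hI, rfl⟩ ⟨J, hJ, hIJ⟩
  have e : J = I := CubicANFPair.encode_injective hIJ
  subst e
  have := hδ J.n
  linarith [hI.2, hJ.2]

end Dial

end Summit.QuantumAdvantage.QuantumAdvantage.Theorems.GapDial

end
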